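import Summits.BirchSwinnertonDyer.BirchSwinnertonDyer.Theorems.ManinLocalTwoThreeShimuraRationalThreeIsogeny
import Literature.NumberTheory.EllipticCurves.ShimuraSubgroupEisensteinProofs
import HarnessLib

/-!
# The Eisenstein sieve: at ANY level with `p² ∣ N`, one good prime `ℓ` with `p ∤ a_ℓ(E) − ℓ − 1` forces
# `Λ₁(f) = Λ₀(f)` and `|c₀| = |c₁|` — so C2 / C3 on `D₀` is Stevens' parity for `D₁`

Summit `BirchSwinnertonDyer`, route `ManinLocalTwoThree` (cell bsd-f2-manin), cruxes C2 `ManinOddAtFour` (stmt-…-22967) and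
C3 `ManinPrimeToThreeAtNine` (stmt-…-22968).  The `N = 4p^k` / `9p^k` theorems of this seat excluded the index-`4` resp. index-`9`
configurations by the group theory of `(ℤ/N)ˣ/±1`; at a general level that group has large `2`-rank resp. `3`-rank.  Ribet's theorem
«the Shimura subgroup is EISENSTEIN» in period-lattice form (`Literature/…/ShimuraSubgroupEisensteinProofs.lean`, p640203:
`(a_ℓ − ℓ − 1)Λ₀(f) ⊆ Λ₁(f)` for every prime `ℓ ∤ N`) replaces it by a per-curve decidable hypothesis — the es planner's
«Hecke sieve» (MEMO-es §31 §4c/§4d) as a THEOREM at every level: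

* `periodLatticeGamma1_eq_of_sq_dvd_of_not_dvd_eisenstein` — `p² ∣ N` (`p` prime, so `a_p = 0` and `pΛ₀ ⊆ Λ₁`), `ℓ ∤ N` prime
  with `p ∤ a_ℓ(W₀) − ℓ − 1` ⟹ `Λ₁(f) = Λ₀(f)` (Bézout);
* `natAbs_maninConstant₀_eq_of_not_dvd_eisenstein` — then `|c₀| = |c₁|` for the optimal pair, and `m ∣ c₀ ⟺ m ∣ c₁`;
* `stevens_eq_optimal_of_odd_coeff` — **`4 ∣ N`, some good prime `ℓ` with `a_ℓ(W₀)` ODD (`E₀(𝔽_ℓ)[2] = 0`) ⟹ `Λ₁ = Λ₀`,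
  `|c₀| = |c₁|`, `2 ∤ c₀ ⟺ 2 ∤ c₁`**;
* `stevens_eq_optimal_of_not_three_dvd_eisenstein` — **`9 ∣ N`, some good `ℓ` with `3 ∤ a_ℓ(W₀) − ℓ − 1` (`E₀[3]` not
  Eisenstein at `ℓ`) ⟹ `Λ₁ = Λ₀`, `|c₀| = |c₁|`, `3 ∤ c₀ ⟺ 3 ∤ c₁`**.

HONEST FRAMING: structure only; the existence of such an `ℓ` for `E[p]` irreducible is Chebotarev (not invoked); C2, C3,
Manin's conjecture and BSD are not proved.  No definitions.
-/

set_option autoImplicit false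
-- the summit-side namespace `Summit.BirchSwinnertonDyer.BirchSwinnertonDyer.…` is the tree's (summit = sub-problem)
set_option linter.dupNamespace false

noncomputable section

open WeierstrassCurve Literature.NumberTheory.EllipticCurves Literature.NumberTheory.EllipticCurves.ModularForms
open CongruenceSubgroup

namespace Summit.BirchSwinnertonDyer.BirchSwinnertonDyer.Theorems.ManinLocalTwoThree

variable {W₁ W₀ : WeierstrassCurve ℚ} [W₁.IsElliptic] [W₁.IsGloballyMinimal] [W₀.IsElliptic]
  [W₀.IsGloballyMinimal] {N : ℕ} [NeZero N]

omit [W₀.IsElliptic] [W₀.IsGloballyMinimal] in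
/-- **The Eisenstein sieve on the period lattices.**  For the newform `f` of `W₀` at a level with `p² ∣ N` (`p` prime:
`a_p(f) = 0`, so `pΛ₀(f) ⊆ Λ₁(f)`, Ling–Oesterlé) and a prime `ℓ ∤ N` with `p ∤ a_ℓ(W₀) − ℓ − 1` (Ribet:
`(a_ℓ − ℓ − 1)Λ₀(f) ⊆ Λ₁(f)`): `Λ₁(f) = Λ₀(f)`. -/
theorem periodLatticeGamma1_eq_of_sq_dvd_of_not_dvd_eisenstein {p ℓ : ℕ} (hp : p.Prime) (hpN : p ^ 2 ∣ N)
    (hℓ : ℓ.Prime) (hℓN : ¬ ℓ ∣ N) (D₀ : ModularParametrizationData W₀ N)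
    (hnd : ¬ (p : ℤ) ∣ W₀.LFunction ℓ - ℓ - 1) :
    periodLatticeGamma1 D₀.f = periodLattice D₀.f := by
  haveI : NeZero ℓ := ⟨hℓ.ne_zero⟩
  have hT : heckeT (Gamma0 N) 2 ℓ D₀.f = ((W₀.LFunction ℓ : ℤ) : ℂ) • D₀.f := by
    have h : heckeT (Gamma0 N) 2 ℓ D₀.f = cuspCoeff D₀.f ℓ • D₀.f := D₀.isNewformOf.1.heckeT_eq_coeff_smul hℓ
    rwa [D₀.isNewformOf.2 ℓ] at h
  have hm : ∀ z ∈ periodLattice D₀.f, ((p : ℤ) : ℂ) * z ∈ periodLatticeGamma1 D₀.f := fun z hz ↦ by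
    have h := pMulLatticeLeGamma1OfTracelessPrime_holds N D₀.f D₀.isNewformOf.1 p hp
      ((dvd_pow_self p two_ne_zero).trans hpN) (D₀.isNewformOf.1.cuspCoeff_eq_zero_of_sq_dvd hp hpN) z hz
    exact_mod_cast h
  have hcop : IsCoprime (p : ℤ) (W₀.LFunction ℓ - ℓ - 1) :=
    ((Nat.prime_iff_prime_int.mp hp).coprime_iff_not_dvd).mpr hnd
  exact periodLatticeGamma1_eq_of_coprime D₀.f hℓ hℓN hT hm hcop

/-- **`|c₀| = |c₁|` under the Eisenstein sieve**: for the optimal `X₁(N)`/`X₀(N)` pair of a class at a level with `p² ∣ N`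
and a good prime `ℓ` with `p ∤ a_ℓ(W₀) − ℓ − 1`. -/
theorem natAbs_maninConstant₀_eq_of_not_dvd_eisenstein {p ℓ : ℕ} (hp : p.Prime) (hpN : p ^ 2 ∣ N) (hℓ : ℓ.Prime)
    (hℓN : ¬ ℓ ∣ N) (D₁ : Gamma1ParametrizationData W₁ N) (D₀ : ModularParametrizationData W₀ N)
    (hiso : IsIsogenous W₁ W₀) (h₁ : D₁.IsOptimal) (h₀ : ∀ z ∈ D₀.L.lattice, ∃ w ∈ periodLattice D₀.f, z = D₀.c * w)
    (hnd : ¬ (p : ℤ) ∣ W₀.LFunction ℓ - ℓ - 1) :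
    periodLatticeGamma1 D₀.f = periodLattice D₀.f ∧ D₀.maninConstant.natAbs = D₁.maninConstant.natAbs := by
  have hf : D₁.f = D₀.f := D₁.f_eq_of_isIsogenous D₀ hiso
  have hΛ := periodLatticeGamma1_eq_of_sq_dvd_of_not_dvd_eisenstein hp hpN hℓ hℓN D₀ hnd
  exact ⟨hΛ, natAbs_maninConstant₀_eq_of_periodLatticeGamma1_eq_periodLattice D₁ D₀ h₁ h₀ hf hΛ⟩

/-- Divisor form: under the Eisenstein sieve, `m ∣ c₀ ⟺ m ∣ c₁` for every integer `m`. -/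
theorem dvd_maninConstant₀_iff_of_not_dvd_eisenstein {p ℓ : ℕ} (hp : p.Prime) (hpN : p ^ 2 ∣ N) (hℓ : ℓ.Prime)
    (hℓN : ¬ ℓ ∣ N) (D₁ : Gamma1ParametrizationData W₁ N) (D₀ : ModularParametrizationData W₀ N)
    (hiso : IsIsogenous W₁ W₀) (h₁ : D₁.IsOptimal) (h₀ : ∀ z ∈ D₀.L.lattice, ∃ w ∈ periodLattice D₀.f, z = D₀.c * w)
    (hnd : ¬ (p : ℤ) ∣ W₀.LFunction ℓ - ℓ - 1) (m : ℤ) :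
    m ∣ D₀.maninConstant ↔ m ∣ D₁.maninConstant := by
  have heq := (natAbs_maninConstant₀_eq_of_not_dvd_eisenstein hp hpN hℓ hℓN D₁ D₀ hiso h₁ h₀ hnd).2
  rw [← Int.natAbs_dvd_natAbs, ← Int.natAbs_dvd_natAbs (b := D₁.maninConstant), heq]

/-! ### C2 side: `4 ∣ N` and an odd `a_ℓ` -/

/-- **At ANY level `4 ∣ N`: one good prime `ℓ` with `a_ℓ(W₀)` odd ⟹ `Λ₁(f) = Λ₀(f)` and `|c₀| = |c₁|`** (`ℓ` is odd as
`ℓ ∤ N`, so `a_ℓ − ℓ − 1 ≡ a_ℓ (mod 2)`; `a_ℓ` odd means `E₀(𝔽_ℓ)` has no `2`-torsion — it happens for some `ℓ` exactly when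
the `2`-division cubic is irreducible, by Chebotarev, not used here). -/
theorem stevens_eq_optimal_of_odd_coeff {ℓ : ℕ} (hℓ : ℓ.Prime) (hℓN : ¬ ℓ ∣ N) (h4 : 2 ^ 2 ∣ N)
    (D₁ : Gamma1ParametrizationData W₁ N) (D₀ : ModularParametrizationData W₀ N) (hiso : IsIsogenous W₁ W₀)
    (h₁ : D₁.IsOptimal) (h₀ : ∀ z ∈ D₀.L.lattice, ∃ w ∈ periodLattice D₀.f, z = D₀.c * w)
    (hodd : Odd (W₀.LFunction ℓ)) :
    periodLatticeGamma1 D₀.f = periodLattice D₀.f ∧ D₀.maninConstant.natAbs = D₁.maninConstant.natAbs := by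
  refine natAbs_maninConstant₀_eq_of_not_dvd_eisenstein Nat.prime_two h4 hℓ hℓN D₁ D₀ hiso h₁ h₀ ?_
  -- `ℓ` is odd (`2 ∣ N`, `ℓ ∤ N`), so `a_ℓ − ℓ − 1` is odd
  have hℓ2 : ℓ ≠ 2 := by
    rintro rfl; exact hℓN ((dvd_pow_self 2 two_ne_zero).trans h4)
  have hℓodd : Odd (ℓ : ℤ) := by exact_mod_cast hℓ.odd_of_ne_two hℓ2
  have e : W₀.LFunction ℓ - ℓ - 1 = W₀.LFunction ℓ - (ℓ + 1) := by ring
  have hodd' : Odd (W₀.LFunction ℓ - ℓ - 1) := by rw [e]; exact hodd.sub_even (hℓodd.add_one)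
  rw [← Int.not_even_iff_odd, even_iff_two_dvd] at hodd'
  exact_mod_cast hodd'

/-- **C2 on `D₀` ⟺ Stevens' parity for `D₁`, at any `4 ∣ N` with an odd `a_ℓ(W₀)`**: `2 ∤ c₀ ⟺ 2 ∤ c₁`. -/
theorem not_two_dvd_maninConstant₀_iff_of_odd_coeff {ℓ : ℕ} (hℓ : ℓ.Prime) (hℓN : ¬ ℓ ∣ N) (h4 : 2 ^ 2 ∣ N)
    (D₁ : Gamma1ParametrizationData W₁ N) (D₀ : ModularParametrizationData W₀ N) (hiso : IsIsogenous W₁ W₀)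
    (h₁ : D₁.IsOptimal) (h₀ : ∀ z ∈ D₀.L.lattice, ∃ w ∈ periodLattice D₀.f, z = D₀.c * w)
    (hodd : Odd (W₀.LFunction ℓ)) :
    ¬ (2 : ℤ) ∣ D₀.maninConstant ↔ ¬ (2 : ℤ) ∣ D₁.maninConstant := by
  have heq := (stevens_eq_optimal_of_odd_coeff hℓ hℓN h4 D₁ D₀ hiso h₁ h₀ hodd).2
  rw [← Int.natAbs_dvd_natAbs, ← Int.natAbs_dvd_natAbs (b := D₁.maninConstant), heq]

/-! ### C3 side: `9 ∣ N` and a non-Eisenstein `a_ℓ` at `3` -/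

/-- **At ANY level `9 ∣ N`: one good prime `ℓ` with `3 ∤ a_ℓ(W₀) − ℓ − 1` ⟹ `Λ₁(f) = Λ₀(f)` and `|c₀| = |c₁|`.** -/
theorem stevens_eq_optimal_of_not_three_dvd_eisenstein {ℓ : ℕ} (hℓ : ℓ.Prime) (hℓN : ¬ ℓ ∣ N) (h9 : 3 ^ 2 ∣ N)
    (D₁ : Gamma1ParametrizationData W₁ N) (D₀ : ModularParametrizationData W₀ N) (hiso : IsIsogenous W₁ W₀)
    (h₁ : D₁.IsOptimal) (h₀ : ∀ z ∈ D₀.L.lattice, ∃ w ∈ periodLattice D₀.f, z = D₀.c * w)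
    (hnd : ¬ (3 : ℤ) ∣ W₀.LFunction ℓ - ℓ - 1) :
    periodLatticeGamma1 D₀.f = periodLattice D₀.f ∧ D₀.maninConstant.natAbs = D₁.maninConstant.natAbs :=
  natAbs_maninConstant₀_eq_of_not_dvd_eisenstein Nat.prime_three h9 hℓ hℓN D₁ D₀ hiso h₁ h₀ (by exact_mod_cast hnd)

/-- **C3 on `D₀` ⟺ «`3 ∤ c₁`» for Stevens' datum, at any `9 ∣ N` with a non-Eisenstein `a_ℓ(W₀)` at `3`.** -/
theorem not_three_dvd_maninConstant₀_iff_of_not_three_dvd_eisenstein {ℓ : ℕ} (hℓ : ℓ.Prime) (hℓN : ¬ ℓ ∣ N)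
    (h9 : 3 ^ 2 ∣ N) (D₁ : Gamma1ParametrizationData W₁ N) (D₀ : ModularParametrizationData W₀ N)
    (hiso : IsIsogenous W₁ W₀) (h₁ : D₁.IsOptimal) (h₀ : ∀ z ∈ D₀.L.lattice, ∃ w ∈ periodLattice D₀.f, z = D₀.c * w)
    (hnd : ¬ (3 : ℤ) ∣ W₀.LFunction ℓ - ℓ - 1) :
    ¬ (3 : ℤ) ∣ D₀.maninConstant ↔ ¬ (3 : ℤ) ∣ D₁.maninConstant := by
  have heq := (stevens_eq_optimal_of_not_three_dvd_eisenstein hℓ hℓN h9 D₁ D₀ hiso h₁ h₀ hnd).2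
  rw [← Int.natAbs_dvd_natAbs, ← Int.natAbs_dvd_natAbs (b := D₁.maninConstant), heq]

/-! ### Contrapositives: doubling / tripling force an Eisenstein newform at every good prime -/

/-- **A doubled optimal pair has ALL good coefficients even**: at `4 ∣ N`, `|c₀| = 2|c₁|` ⟹ `a_ℓ(W₀)` is even for every
prime `ℓ ∤ N` (the newform is Eisenstein mod `2` away from `N`; by Chebotarev — not used — `W₀` then has a rational
`2`-torsion point or a cyclic cubic field of `2`-division, consistent with `trichotomy_shimura_of_four_dvd_level_anyModel`). -/
theorem even_coeff_of_natAbs_eq_two_mul {ℓ : ℕ} (hℓ : ℓ.Prime) (hℓN : ¬ ℓ ∣ N) (h4 : 2 ^ 2 ∣ N)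
    (D₁ : Gamma1ParametrizationData W₁ N) (D₀ : ModularParametrizationData W₀ N) (hiso : IsIsogenous W₁ W₀)
    (h₁ : D₁.IsOptimal) (h₀ : ∀ z ∈ D₀.L.lattice, ∃ w ∈ periodLattice D₀.f, z = D₀.c * w)
    (hdouble : D₀.maninConstant.natAbs = 2 * D₁.maninConstant.natAbs) : Even (W₀.LFunction ℓ) := by
  by_contra hodd
  rw [Int.not_even_iff_odd] at hodd
  have heq := (stevens_eq_optimal_of_odd_coeff hℓ hℓN h4 D₁ D₀ hiso h₁ h₀ hodd).2
  have hne : D₁.maninConstant.natAbs ≠ 0 := Int.natAbs_ne_zero.mpr D₁.maninConstant_ne_zero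
  omega

/-- **Index `4` forces all good coefficients even**: `Λ₁(f) = 2Λ₀(f)` ⟹ `a_ℓ(W₀)` even for every prime `ℓ ∤ N`
(E-an-68: index `4` ⟹ `|c₀| = 2|c₁|`). -/
theorem even_coeff_of_index_four {ℓ : ℕ} (hℓ : ℓ.Prime) (hℓN : ¬ ℓ ∣ N) (h4 : 2 ^ 2 ∣ N)
    (D₁ : Gamma1ParametrizationData W₁ N) (D₀ : ModularParametrizationData W₀ N) (hiso : IsIsogenous W₁ W₀)
    (h₁ : D₁.IsOptimal) (h₀ : ∀ z ∈ D₀.L.lattice, ∃ w ∈ periodLattice D₀.f, z = D₀.c * w)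
    (hidx : ∀ z : ℂ, z ∈ periodLatticeGamma1 D₁.f ↔ ∃ w ∈ periodLattice D₀.f, z = 2 * w) : Even (W₀.LFunction ℓ) :=
  even_coeff_of_natAbs_eq_two_mul hℓ hℓN h4 D₁ D₀ hiso h₁ h₀
    (natAbs_maninConstant₀_eq_two_mul_of_index_four D₁ D₀ h₁ h₀ hidx)

/-- **A tripled optimal pair is Eisenstein mod `3` at every good prime**: at `9 ∣ N`, `|c₀| = 3|c₁|` ⟹ `3 ∣ a_ℓ(W₀) − ℓ − 1`
for every prime `ℓ ∤ N` (by Chebotarev and Brauer–Nesbitt — not used — `W₀[3]` is then reducible: a rational `3`-isogeny,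
consistent with `index_nine_or_velu_three_of_tripled`). -/
theorem three_dvd_eisenstein_of_natAbs_eq_three_mul {ℓ : ℕ} (hℓ : ℓ.Prime) (hℓN : ¬ ℓ ∣ N) (h9 : 3 ^ 2 ∣ N)
    (D₁ : Gamma1ParametrizationData W₁ N) (D₀ : ModularParametrizationData W₀ N) (hiso : IsIsogenous W₁ W₀)
    (h₁ : D₁.IsOptimal) (h₀ : ∀ z ∈ D₀.L.lattice, ∃ w ∈ periodLattice D₀.f, z = D₀.c * w)
    (htri : D₀.maninConstant.natAbs = 3 * D₁.maninConstant.natAbs) : (3 : ℤ) ∣ W₀.LFunction ℓ - ℓ - 1 := by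
  by_contra hnd
  have heq := (stevens_eq_optimal_of_not_three_dvd_eisenstein hℓ hℓN h9 D₁ D₀ hiso h₁ h₀ hnd).2
  have hne : D₁.maninConstant.natAbs ≠ 0 := Int.natAbs_ne_zero.mpr D₁.maninConstant_ne_zero
  omega

omit [W₀.IsElliptic] [W₀.IsGloballyMinimal] in
/-- **`Λ₁(f) ≠ Λ₀(f)` at `9 ∣ N` forces Eisenstein mod `3` at every good prime** (lattice form, no optimal pair needed):
for the newform of `W₀` at a level `9 ∣ N`, if some prime `ℓ ∤ N` has `3 ∤ a_ℓ(W₀) − ℓ − 1` then the Shimura cover of the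
class is trivial. -/
theorem three_dvd_eisenstein_of_periodLatticeGamma1_ne {ℓ : ℕ} (hℓ : ℓ.Prime) (hℓN : ¬ ℓ ∣ N) (h9 : 3 ^ 2 ∣ N)
    (D₀ : ModularParametrizationData W₀ N) (hne : periodLatticeGamma1 D₀.f ≠ periodLattice D₀.f) :
    (3 : ℤ) ∣ W₀.LFunction ℓ - ℓ - 1 := by
  by_contra hnd
  exact hne (periodLatticeGamma1_eq_of_sq_dvd_of_not_dvd_eisenstein Nat.prime_three h9 hℓ hℓN D₀ (by exact_mod_cast hnd))

end Summit.BirchSwinnertonDyer.BirchSwinnertonDyer.Theorems.ManinLocalTwoThree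

end
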